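import Mathlib
import HarnessLib
import Literature.AlgebraicGeometry.HodgeTheory.HodgeModelChernNormalised
import Literature.AlgebraicGeometry.HodgeTheory.AlgebraicClasses
import Literature.AlgebraicGeometry.Motives.HodgeDecomposition
import Literature.Geometry.Kaehler.KaehlerFormPower
import Literature.Geometry.Kaehler.AnalyticSet
import Literature.Geometry.GeometricMeasureTheory.CurrentsRepresentable
import Literature.Geometry.GeometricMeasureTheory.CurrentsVariationMeasure
import Literature.NumberTheory.Transcendental.FormIntegration
import Literature.NumberTheory.Transcendental.FormsAlgebra
import Literature.NumberTheory.Transcendental.ComplexForms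

/-!
# Strongly positive forms, Kähler embeddings of Hodge models, and mass-minimizing integral cycles

Topic `Literature/AlgebraicGeometry/HodgeTheory`. The statement-level vocabulary of the
geometric-measure-theory approach to positive rational Hodge classes (Lawson, *Minimal
varieties*, PSPM 27 (1975), §5, Conj. 5.15; *The stable homology of a flat torus*, Math. Scand. 36
(1975); Harvey–Knapp (1974); Federer (1969), Ch. 5; King (1971); Harvey–Shiffman (1974)):

* `stronglyPositiveGenerators`, `stronglyPositiveCone`, `IsStrictlyStronglyPositive` — the
  pointwise STRONGLY positive cone of real `2p`-covectors on a complex normed space (convex cone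
  generated by the pull-backs of the volume form `K_p = ω₀^p/p!` of `ℂᵖ` along `ℂ`-linear maps) and
  its relative (= intrinsic) interior; `IsPositiveForm`, `IsStrictlyPositiveForm` for real
  `2p`-forms on a complex manifold (pointwise conditions).
* `HodgeModel.FormRepresents A k α c` — the closed real form `α` represents the Betti class
  `c ∈ Hᵏ(X(ℂ); ℂ)` through the model's de Rham comparison.
* `Current.IsCycle` — closed currents (boundary zero), pattern-matched on the dimension.
* `KaehlerEmbedding A V` — a real-analytic injective immersion of the Hodge model into a
  finite-dimensional real inner product space with induced metric Kähler, a continuous orientation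
  of positive Kähler volume, on a Chern-normalised model (the Fubini–Study/Veronese situation), so
  that the tree's Euclidean currents (`Literature.Geometry.GeometricMeasureTheory.Current`) carried
  by the image play the role of currents on `X`;
  and over it: `pullbackForm`, `IsPositiveTestForm`, `pairing` (`∫ α ∧ ι^*Φ`), `size`
  (`∫ α ∧ ω^q/q!`), `Represents` (integral cycle carried by `ι(X)` with the periods of `k·PD[α]`),
  `IsMassMinimizing` (Federer–Fleming minimizer in that class), `holLocus` (positively holomorphic
  regular locus of a current).

Design choices. (1) Currents live in the ambient Euclidean space (the tree has no currents on
abstract manifolds); the class of a cycle is pinned down by its periods on ambient test forms whose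
pull-back is closed (every closed form on `X^an` extends to such a form via a tubular
neighbourhood retraction; for cycles carried by the embedded submanifold the value on `Φ` depends
only on `ι^*Φ`, Federer (1969), 4.1.31 and 5.4.1). (2) Strict positivity is the RELATIVE interior of
the strongly positive cone (`intrinsicInterior`): the cone spans only the real `(p,p)`-covectors, so
its topological interior in all `2p`-covectors is empty for `0 < p < dim`. (3) The holomorphic locus
is defined through the support and local positivity only (no tangent-plane measure theory): for a
closed locally rectifiable current this is the open set where the current is a positive integer
multiple of a `q`-dimensional complex submanifold (constancy theorem). (4) Instance-dependent
fields of `KaehlerEmbedding` (`IsContinuousOrientation`, the Kähler volume) are stated under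
instance binders `[Fact (finrank ℝ A.model = 2 * n)]`, `[MeasurableSpace A.model] [BorelSpace A.model]`
exactly as the tree's integration theory expects them (cf. `HodgeRiemannDegreeOne`).

NOT here: no theorem about these notions beyond unfolding lemmas — Wirtinger's inequality for
`size`, existence of minimizers, King's structure theorem and the regularity theory are cited where
used (route `GmtVisibleFractionBootstrap` of the Hodge summit) and enter as named facts when needed.

## References

* H. B. Lawson, Jr., *Minimal varieties*, Proc. Sympos. Pure Math. 27, Part 1 (1975), 143–175, §5
  (positive `(p,p)`-vectors p. 203 of the Chern volume; Conj. 5.15; the boundary example and the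
  ballast reformulation p. 206). [Lawson1975MinimalVarieties]
* H. B. Lawson, Jr., *The stable homology of a flat torus*, Math. Scand. 36 (1975), 49–73.
  [Lawson1975StableHomology]
* R. Harvey, A. W. Knapp, *Positive (p,p) forms, Wirtinger's inequality, and currents* (1974), §1,
  Cor. 1.10. [HarveyKnapp1974]
* H. Federer, *Geometric Measure Theory* (1969), 4.1.7, 4.1.31, 4.4.1, 5.1.6, 5.4.1, 5.4.19.
  [Federer1969]
* J. King, *The currents defined by analytic varieties*, Acta Math. 127 (1971). [King1971]
* C. Voisin, *Hodge Theory and Complex Algebraic Geometry I* (2002), §7.1.1, §11.3. [VoisinHodgeI2002]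
-/

noncomputable section

set_option maxSynthPendingDepth 2

open scoped Manifold ContDiff Topology NNReal ENNReal RealInnerProductSpace
open Set Function Module Filter

namespace Literature.AlgebraicGeometry.HodgeTheory

open _root_.MeasureTheory _root_.TopologicalSpace
open Literature.Geometry.Kaehler Literature.Geometry.GeometricMeasureTheory
  Literature.NumberTheory.Transcendental

/-! ## Pointwise strong positivity -/
section Pointwise

variable (E : Type*) [NormedAddCommGroup E] [NormedSpace ℂ E]

/-- The **generators of the strongly positive cone** in real degree `2p` on a complex normed space
`E`: the pull-backs `L^* K_p` of the normalised Kähler power `K_p = ω₀^p / p!` of `ℂᵖ` (the standard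
volume form of `ℂᵖ`, `Literature.Geometry.Kaehler.kaehlerPow`) along the `ℂ`-linear maps
`L : E → ℂᵖ`. For `E = T_x X` these are the volume elements of canonically oriented complex
`p`-planes composed with `ℂ`-linear projections — Lawson's "positive `(p,p)`-vectors … sums of simple
vectors of canonically oriented complex `p`-planes" on the form side; Harvey–Knapp's strongly positive
decomposable forms `i^{p} λ₁∧λ̄₁∧…∧λ_p∧λ̄_p`. [cite: HarveyKnapp1974, §1] -/
def stronglyPositiveGenerators (p : ℕ) : Set (E [⋀^Fin (2 * p)]→L[ℝ] ℝ) :=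
  Set.range fun L : E →L[ℂ] EuclideanSpace ℂ (Fin p) ↦
    (kaehlerPow (V := EuclideanSpace ℂ (Fin p)) p).compContinuousLinearMap (L.restrictScalars ℝ)

/-- The **strongly positive cone** `SP^p(E)`: the convex cone (non-negative real combinations)
generated by the pull-backs `L^* K_p`, `L : E →_ℂ ℂᵖ` (Harvey–Knapp (1974), §1; Lawson, PSPM 27
(1975), p. 203; Demailly, *Complex analytic and differential geometry*, III.1.1–1.5: strongly
positive forms are the convex cone spanned by the `i λ₁∧λ̄₁∧…∧i λ_p∧λ̄_p`). Every element is a real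
form of type `(p,p)`. [cite: HarveyKnapp1974, §1] [cite: Lawson1975MinimalVarieties, §5 p. 203] -/
def stronglyPositiveCone (p : ℕ) : Submodule ℝ≥0 (E [⋀^Fin (2 * p)]→L[ℝ] ℝ) :=
  Submodule.span ℝ≥0 (stronglyPositiveGenerators E p)

/-- A real `2p`-covector is **strictly strongly positive** if it lies in the RELATIVE interior of
the strongly positive cone (interior inside the cone's own span, the real `(p,p)`-covectors — the
cone has empty interior in all `2p`-covectors for `0 < p`, whence `intrinsicInterior`, not
`interior`). Example: `K_p` itself on a Hermitian space (Harvey–Knapp (1974), Cor. 1.10: `ω^p` is an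
interior point). [cite: HarveyKnapp1974, Cor. 1.10] -/
def IsStrictlyStronglyPositive (p : ℕ) (u : E [⋀^Fin (2 * p)]→L[ℝ] ℝ) : Prop :=
  u ∈ intrinsicInterior ℝ (stronglyPositiveCone E p : Set (E [⋀^Fin (2 * p)]→L[ℝ] ℝ))

end Pointwise

/-! ## Positive forms and form representatives of Betti classes on a Hodge model -/
section Forms

variable {E : Type*} [NormedAddCommGroup E] [NormedSpace ℂ E] {M : Type*} [TopologicalSpace M]
  [ChartedSpace E M]

/-- A real `2p`-form is **positive** (in the strong sense) if it is pointwise in the strongly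
positive cone. [cite: HarveyKnapp1974, §1] -/
def IsPositiveForm (p : ℕ) (α : MForm 𝓘(ℝ, E) M ℝ (2 * p)) : Prop :=
  ∀ x, (α x : E [⋀^Fin (2 * p)]→L[ℝ] ℝ) ∈ stronglyPositiveCone E p

/-- A real `2p`-form is **strictly positive** if it is pointwise strictly strongly positive
(pointwise in the relative interior of the strongly positive cone), e.g. `ω^p` for a Kähler form
`ω`. Lawson's cone `K^{2p}` is the set of classes of closed such forms. [cite: HarveyKnapp1974, Cor. 1.10] -/
def IsStrictlyPositiveForm (p : ℕ) (α : MForm 𝓘(ℝ, E) M ℝ (2 * p)) : Prop :=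
  ∀ x, IsStrictlyStronglyPositive E p (α x : E [⋀^Fin (2 * p)]→L[ℝ] ℝ)

variable {n : ℕ} {X : Motives.SchemeOver ℂ}

/-- **A closed real form represents a Betti class** on a Hodge model `A` of `X`: the complexified
form `α ⊗ 1` is a closed smooth complex `k`-form and its de Rham class is carried by the model's
de Rham comparison `A.deRham` to the pull-back of `c ∈ Hᵏ(X(ℂ); ℂ)`. (For a Chern-normalised model
this is "the periods of `α` are those of `c`".) [cite: VoisinHodgeI2002, §7.1.1 and §11.3] -/
def HodgeModel.FormRepresents (A : HodgeModel n X) (k : ℕ) (α : MForm 𝓘(ℝ, A.model) A.carrier ℝ k)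
    (c : complexBetti X k) : Prop :=
  ∃ h : α.ofReal ∈ cclosedSmoothForms A.model A.carrier k,
    A.pullback k c = A.deRham A.carrier k (complexDeRhamCohomology.mk A.model A.carrier k ⟨α.ofReal, h⟩)

end Forms

/-! ## Closed currents -/
section Cycle

variable {V : Type*} [NormedAddCommGroup V] [NormedSpace ℝ V] {Ω : Opens V}

/-- A current is a **cycle** (is closed) if its boundary vanishes; vacuous in dimension `0`.
Dot-notation extension of `Literature.Geometry.GeometricMeasureTheory.Current` declared from the
Hodge-theory directory (pattern-matched on the dimension like `Current.IsIntegral`).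
[cite: Federer1969, 4.1.7 and 4.1.24] -/
def _root_.Literature.Geometry.GeometricMeasureTheory.Current.IsCycle :
    {m : ℕ} → Current Ω m → Prop
  | 0, _ => True
  | _ + 1, T => T.boundary = 0

/-- Unfolding `IsCycle` in positive dimension. [cite: Federer1969, 4.1.7] -/
@[simp]
theorem _root_.Literature.Geometry.GeometricMeasureTheory.Current.isCycle_succ_iff {m : ℕ}
    (T : Current Ω (m + 1)) : T.IsCycle ↔ T.boundary = 0 :=
  Iff.rfl

/-- Every `0`-dimensional current is a cycle. [cite: Federer1969, 4.1.7] -/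
@[simp]
theorem _root_.Literature.Geometry.GeometricMeasureTheory.Current.isCycle_zero_dim
    (T : Current Ω 0) : T.IsCycle :=
  trivial

/-- The zero current is a cycle. [cite: Federer1969, 4.1.7] -/
theorem _root_.Literature.Geometry.GeometricMeasureTheory.Current.isCycle_zero {m : ℕ} :
    (0 : Current Ω m).IsCycle := by
  cases m with
  | zero => trivial
  | succ m => simp [Current.IsCycle, Current.boundary]

end Cycle

/-! ## Kähler embeddings of a Hodge model into a Euclidean space -/
section Embedding

variable {n : ℕ} {X : Motives.SchemeOver ℂ}

/-- A **Kähler embedding of a Hodge model** `A` of the smooth projective `n`-fold `X` into a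
finite-dimensional real inner product space `V`: a real-analytic injective immersion
`ι : X^an → V` together with the induced (pulled-back Euclidean) smooth Riemannian metric `g`, which
is required to be KÄHLER for the complex structure of `X^an`, a continuous orientation family `o`
of positive Kähler volume `∫ ω^n > 0` (the complex orientation), on a CHERN-NORMALISED model (de Rham
comparison = integration). Example: a Hodge model of `X ⊆ ℙᴺ` composed with the (real-analytic,
isometric, `U(N+1)`-equivariant) embedding of `(ℙᴺ, g_FS)` into the Euclidean space of Hermitian
matrices, `[z] ↦ z z^* / |z|²`; the induced metric is the restricted Fubini–Study metric, which is
Kähler (Griffiths–Harris, p. 31; Lawson, PSPM 27 (1975), §5). This is the setting in which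
Federer–Fleming mass-minimizing integral currents "on `X`" are currents in `V` carried by `ι(X^an)`
(Federer (1969), 5.4.1, currents in a submanifold of `ℝᴺ`). [cite: Federer1969, 4.1.7 and 5.4.1] -/
structure KaehlerEmbedding (A : HodgeModel n X) (V : Type) [NormedAddCommGroup V]
    [InnerProductSpace ℝ V] [FiniteDimensional ℝ V] where
  /-- the embedding `ι : X^an → V` -/
  toFun : A.carrier → V
  /-- the induced smooth Riemannian metric on `X^an` -/
  metric : Bundle.ContMDiffRiemannianMetric 𝓘(ℝ, A.model) ∞ A.model
    (fun x : A.carrier ↦ TangentSpace 𝓘(ℝ, A.model) x)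
  /-- the orientation family used for integration of top forms -/
  orientation : (x : A.carrier) → Orientation ℝ (TangentSpace 𝓘(ℝ, A.model) x) (Fin (2 * n))
  /-- the model is Chern-normalised (de Rham comparison = integration over cycles) -/
  isChernNormalised : A.IsChernNormalised
  /-- `ι` is real-analytic -/
  contMDiff : ContMDiff 𝓘(ℝ, A.model) 𝓘(ℝ, V) ω toFun
  /-- `ι` is injective -/
  injective : Function.Injective toFun
  /-- `ι` is an immersion -/
  injective_mfderiv : ∀ x, Function.Injective (mfderiv 𝓘(ℝ, A.model) 𝓘(ℝ, V) toFun x)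
  /-- the metric is the one induced from the Euclidean structure of `V` along `ι` -/
  inner_eq : ∀ (x : A.carrier) (v w : TangentSpace 𝓘(ℝ, A.model) x),
    metric.inner x v w =
      @inner ℝ V _ (mfderiv 𝓘(ℝ, A.model) 𝓘(ℝ, V) toFun x v)
        (mfderiv 𝓘(ℝ, A.model) 𝓘(ℝ, V) toFun x w)
  /-- the induced metric is Kähler for the complex structure of the model -/
  isKaehler : metric.toRiemannianMetric.IsKaehler
  /-- the orientation family is continuous -/
  isContinuousOrientation : ∀ [Fact (finrank ℝ A.model = 2 * n)],
    IsContinuousOrientation (I := 𝓘(ℝ, A.model)) orientation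
  /-- the orientation is the complex one: the Kähler volume is positive -/
  integral_kaehlerFormPow_pos : ∀ [Fact (finrank ℝ A.model = 2 * n)] [MeasurableSpace A.model]
    [BorelSpace A.model],
    0 < MForm.integral orientation (Motives.kaehlerFormPow metric.toRiemannianMetric n)

namespace KaehlerEmbedding

variable {A : HodgeModel n X} {V : Type} [NormedAddCommGroup V] [InnerProductSpace ℝ V]
  [FiniteDimensional ℝ V] [MeasurableSpace V] [BorelSpace V] (S : KaehlerEmbedding A V)

/-- Pull-back `ι^*Φ` of an ambient test form to the Hodge model. [cite: Federer1969, 4.1.7] -/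
def pullbackForm {m : ℕ} (Φ : TestForm (⊤ : Opens V) m) : MForm 𝓘(ℝ, A.model) A.carrier ℝ m :=
  MForm.pullback (I' := 𝓘(ℝ, V)) (N := V) 𝓘(ℝ, A.model) S.toFun
    (fun y : V ↦ (Φ y : V [⋀^Fin m]→L[ℝ] ℝ))

/-- An ambient test `2q`-form is **positive along the embedding** if its pull-back `ι^*Φ` is a
positive `(q,q)`-form on `X^an`. [cite: HarveyKnapp1974, §1] -/
def IsPositiveTestForm (q : ℕ) (Φ : TestForm (⊤ : Opens V) (2 * q)) : Prop :=
  IsPositiveForm q (S.pullbackForm Φ)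

variable [Fact (finrank ℝ A.model = 2 * n)] [MeasurableSpace A.model] [BorelSpace A.model]

/-- The period pairing `∫_{X^an} α ∧ ι^*Φ` of a real `2p`-form with an ambient test `2q`-form,
`p + q = n` (degree bookkeeping `2p + 2q = 2n` by `MForm.castDeg`). [cite: Federer1969, 4.1.7] -/
def pairing {p q : ℕ} (hpq : p + q = n) (α : MForm 𝓘(ℝ, A.model) A.carrier ℝ (2 * p))
    (Φ : TestForm (⊤ : Opens V) (2 * q)) : ℝ :=
  MForm.integral S.orientation
    ((α.wedge (S.pullbackForm Φ)).castDeg (by omega : 2 * p + 2 * q = 2 * n))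

/-- The **calibrated size** `|α| = ∫_{X^an} α ∧ ω^q / q!` of a real `2p`-form (`p + q = n`): for a
closed form it depends only on the class, and by Wirtinger's inequality it is the mass of any
positive holomorphic cycle in the Poincaré-dual class (Federer (1969), 5.4.19; Lawson, PSPM 27,
p. 206). [cite: Federer1969, 5.4.19] -/
def size {p q : ℕ} (hpq : p + q = n) (α : MForm 𝓘(ℝ, A.model) A.carrier ℝ (2 * p)) : ℝ :=
  MForm.integral S.orientation
      ((α.wedge (Motives.kaehlerFormPow S.metric.toRiemannianMetric q)).castDeg
        (by omega : 2 * p + 2 * q = 2 * n)) /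
    (q.factorial : ℝ)

/-- **`T` represents `k · PD[α]`**: `T` is an integral `2q`-cycle of `V` carried by `ι(X^an)` whose
periods on ambient test forms closed along `ι` are `k ∫ α ∧ ι^*Φ` — i.e. `T` is (the push-forward
of) an integral cycle of `X^an` in the integral homology class Poincaré dual to `k[α]` (Federer
(1969), 4.1.7, 4.4.1, 5.4.1; de Rham). [cite: Federer1969, 4.4.1 and 5.4.1] -/
def Represents {p q : ℕ} (hpq : p + q = n) (α : MForm 𝓘(ℝ, A.model) A.carrier ℝ (2 * p)) (k : ℕ)
    (T : Current (⊤ : Opens V) (2 * q)) : Prop :=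
  T.IsIntegral ∧ T.IsCycle ∧ T.support ⊆ Set.range S.toFun ∧
    ∀ Φ : TestForm (⊤ : Opens V) (2 * q), IsClosedForm (S.pullbackForm Φ) →
      T Φ = k * S.pairing hpq α Φ

/-- **Mass-minimizing integral cycle in the class `k · PD[α]`** (Federer–Fleming): a representing
current of least mass among all representing currents. Existence for non-empty classes is
Federer–Fleming compactness plus lower semicontinuity of mass (Federer (1969), 4.2.17, 5.1.6).
[cite: Federer1969, 5.1.6] -/
def IsMassMinimizing {p q : ℕ} (hpq : p + q = n) (α : MForm 𝓘(ℝ, A.model) A.carrier ℝ (2 * p))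
    (k : ℕ) (T : Current (⊤ : Opens V) (2 * q)) : Prop :=
  S.Represents hpq α k T ∧
    ∀ T' : Current (⊤ : Opens V) (2 * q), S.Represents hpq α k T' → T.mass ≤ T'.mass

/-- The **positively holomorphic locus** `hol⁺(T)` of a `2q`-current carried by `ι(X^an)`: the
points of the support near which the support is the image of a `q`-dimensional complex submanifold
(germ of a smooth analytic set of codimension `p`, `IsRegularPointOfCodim`) AND the current is
positive on test forms positive along `ι`. For a closed locally rectifiable `T` this is the open part
of the regular set where `T` is a POSITIVE integer multiple of a complex submanifold (constancy
theorem, Federer (1969), 4.1.31; King (1971), holomorphic chains). [cite: Federer1969, 4.1.31] -/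
def holLocus (p : ℕ) {q : ℕ} (T : Current (⊤ : Opens V) (2 * q)) : Set V :=
  {y | y ∈ T.support ∧ ∃ U : Set V, IsOpen U ∧ y ∈ U ∧
    (∃ Z : Set A.carrier, (∀ z ∈ Z, S.toFun z ∈ U → IsRegularPointOfCodim 𝓘(ℂ, A.model) Z p z) ∧
      T.support ∩ U = S.toFun '' Z ∩ U) ∧
    ∀ Φ : TestForm (⊤ : Opens V) (2 * q), tsupport ⇑Φ ⊆ U → S.IsPositiveTestForm q Φ → 0 ≤ T Φ}

end KaehlerEmbedding

end Embedding

end Literature.AlgebraicGeometry.HodgeTheory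


end
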